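/-
Copyright: the b2b-balaban T⁴-continuum CRUX team, row NE7b leaf lineage `t4-ne7b-formalise-leaf-03` (gen 148). Project licence.
-/
import Mathlib.Analysis.Normed.Operator.Bilinear
import Mathlib.Analysis.Normed.Operator.Mul

/-!
# THE NEXT SCALE'S KERNEL COERCIVITY LETTER `m⁺`: THE TRANSPORTED FORM `Q⁺ = Q[S·, S·]` IS COERCIVE ON `ker D⁺` FROM THE TWO-SCALE
# LETTER «`Q` COERCIVE ON `ker (D⁺ ∘ D)`», WITH `m⁺ = m₂ ∕ d²` (and the growth `Q⁺ k k ≤ ‖Q‖‖S‖²‖k‖²`) — the one letter that stayed displayed for a full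
# inductive hard step (leaf-06 g155 INTENT-2: «what remains displayed … the next-scale equivalence `T⁺` (AHE from a kernel coercivity
# of the transported form)»)
# (row NE7b, node U5c; companion of `…AugmentedHessianEquivalence` (AHE: `T`, `N` from kernel coercivity), leaf-04's HSBD
# (`σ′(w)` = a right inverse `S` of `D` with the propagator letter) and leaf-06's HSTH (`D²(V ∘ σ)(w) = V″(σ w).bilinearComp (σ′ w) (σ′ w)`);
# idea-1 T-92 «Thm 3.12: `G₁⁻¹ > 0` on the slice» at consecutive scales; [folklore])

Cell `pub-balaban`, sub-cell `t4`, spine estimate NE7b (`T4WeightBudget.RelWeightBound`; the cell's OWN estimate — NOT PRINTED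
in [Bałaban 1983–89], NOT PROVED).  Crux-route work under `Spine/NE7b/` by leaf-03 (CRUX team (2), FREEZE (0) crux-prover clause).
NOTHING of Bałaban's is named, asserted, valued or discharged; no `T4Continuum/Support` leaf typed; no `def`; zero `sorry`.  Imports
Mathlib ONLY (`Normed.Operator.Bilinear` ∕ `.Mul`: `bilinearComp`, `le_opNorm₂`, the toy's `mul`) — independent of the `Spine/NE7b` olean frontier; nothing of
AHE ∕ HSBD ∕ HSTH ∕ QFM imported or restated (their objects enter as LETTER SHAPES: a bilinear form `Q`, a right inverse `S`).

WHY.  One inductive hard step on the chart road now reads (leaf-04 g153, l.59012): kernel coercivity `m` + right inverse `M` (AHE) ⟹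
`T, N` ⟹ HSCR (branch `σ`, radius, Lipschitz) ⟹ HSBD (`σ′ = S`, `D ∘ S = 1`, propagator) ⟹ HSBDM ∕ HSTL (moduli) and HSTH: the next
action `V⁺ = V ∘ σ` is `C²` with `D²V⁺(w) = Q⁺_w := V″(σ w).bilinearComp (S w) (S w)`.  To START the next step, AHE at scale `+` asks
for the kernel coercivity of `Q⁺` on `ker D⁺` (`D⁺ : F →L F′` the next averaging) and `‖Q⁺‖` (HSTL).  This file supplies the former from ONE
two-scale letter on the CURRENT form — `Q` coercive with modulus `m₂` on `ker (D⁺ ∘ D) = D⁻¹(ker D⁺)` (which contains `ker D`, so the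
same letter also feeds the current step's AHE) — and the size letter `‖D v‖ ≤ d‖v‖`: for `k ∈ ker D⁺`, `S k ∈ ker (D⁺ ∘ D)` and
`‖k‖ = ‖D (S k)‖ ≤ d‖S k‖`, so `Q⁺ k k = Q (S k) (S k) ≥ m₂‖S k‖² ≥ (m₂∕d²)‖k‖²`.

WHAT IS PROVED ([folklore]; linear algebra of restricted quadratic forms).  `E`, `F`, `F′` real normed spaces, `Q : E →L[ℝ] E →L[ℝ] ℝ`
(NO symmetry), `D : E →L[ℝ] F`, `S : F →L[ℝ] E`, `D⁺ : F →L[ℝ] F′`.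
* §1 SIZE: `bilinearComp_apply'` (`Q.bilinearComp S S k k′ = Q (S k) (S k′)`), `bilinearComp_apply_le` (`Q⁺ k k ≤ ‖Q‖‖S‖²‖k‖²` — the next
  growth letter); the operator-norm form `‖Q.bilinearComp S S′‖ ≤ ‖Q‖‖S‖‖S′‖` is ALREADY in the tree as leaf-06's
  `…HardStepTransportedLetters.norm_bilinearComp_le'` (BY NAME; not imported — its module has no hub olean — and not restated).
* §2 COERCIVITY TRANSPORT: `mem_ker_comp_of_rightInverse` (`D (S k) = k`, `D⁺ k = 0 ⟹ D⁺ (D (S k)) = 0`), `norm_le_mul_norm_rightInverse`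
  (`‖k‖ ≤ d‖S k‖`), **`kerCoercive_bilinearComp`** (division-free: `m₂‖k‖² ≤ d²·Q⁺ k k` on `ker D⁺`),
  **`kerCoercive_bilinearComp_div`** (`0 < d`: `(m₂∕d²)‖k‖² ≤ Q⁺ k k` on `ker D⁺` — AHE's letter `hco` at scale `+` VERBATIM),
  `kerCoercive_of_twoScale` (the two-scale letter RESTRICTS to the current one: `D κ = 0 ⟹ m₂‖κ‖² ≤ Q κ κ`).
* §3 SPECIAL CASES: `coercive_bilinearComp_of_coercive` (`Q` coercive on ALL of `E` ⟹ `Q⁺` coercive on all of `F` with `m∕d²` — the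
  `D⁺ = 0` instance), `kerCoercive_bilinearComp_of_le` (monotone in the letter: any `m′ ≤ m₂∕d²` works), `twoScale_of_coercive`.
* §4 toys (`example`): `E = F = F′ = ℝ`, `Q x y = x·y`, `D = S = id`, `D⁺ = 0`, `m₂ = d = 1`: `1·‖k‖² ≤ Q⁺ k k`; and the TOWER
  use — the same lemma with the composite `D⁺⁺ ∘ D⁺` for `D⁺` hands the step after next its letter on `Q⁺`.

NOT HERE (honest): which `Q, D, D⁺, S` are Bałaban's (`Δ_k` on the axial ∕ Landau slice, the block averagings `Q_k`, `Q_{k+1}` and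
the background derivative — (A3) ∕ (A1c), NC-NE7b-α UNRULED; print's two-scale positivity is [B9] Thm 3.12's business at each `k`);
WHERE the two-scale letter comes from (for print: the small-field Hessian of the Wilson action is coercive on every slice
`{Q_j A = 0}`, `j ≥ k` — a letter BY VALUE); the `w`-dependence of `Q⁺_w` (HSTL ∕ HSBDM's moduli); a right inverse `M⁺` of `D⁺`
(displayed by AHE at scale `+`).  BY-NAME EFFECT ON THE WALL: NONE.  NE7b NOT PRINTED ∕ NOT PROVED; spine PROVED 0∕9; rung (B)+1 on a
FINITE torus — NOT infinite volume, NOT the mass gap, NOT Clay.  HONEST DEPENDENCY: continuum YM on T⁴ ⇐ BetaPertH ∧ nine spine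
estimates (0/9 proved); BetaPertH ⇐ (D1) ∧ (D4) ∧ CAP+tail; G-an2-4 gates asym, D1 and NE2∕3∕4.
-/

set_option autoImplicit false

namespace Summit.QuantumFields.BalabanUV.T4Continuum.NE7b.TransportedFormCoercivity

variable {E F F' : Type*} [NormedAddCommGroup E] [NormedSpace ℝ E] [NormedAddCommGroup F] [NormedSpace ℝ F]
  [NormedAddCommGroup F'] [NormedSpace ℝ F']

/-! ## §1. Size of the transported form -/

/-- The transported form evaluates as `Q.bilinearComp S S′ k k′ = Q (S k) (S′ k′)`. [folklore] -/
theorem bilinearComp_apply' (Q : E →L[ℝ] E →L[ℝ] ℝ) (S S' : F →L[ℝ] E) (k k' : F) :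
    Q.bilinearComp S S' k k' = Q (S k) (S' k') := rfl

/-- THE NEXT GROWTH LETTER: `Q⁺ k k ≤ ‖Q‖‖S‖²‖k‖²`. [folklore] -/
theorem bilinearComp_apply_le (Q : E →L[ℝ] E →L[ℝ] ℝ) (S : F →L[ℝ] E) (k : F) :
    Q.bilinearComp S S k k ≤ ‖Q‖ * ‖S‖ ^ 2 * ‖k‖ ^ 2 := by
  rw [bilinearComp_apply']
  calc Q (S k) (S k) ≤ ‖Q (S k) (S k)‖ := Real.le_norm_self _
    _ ≤ ‖Q‖ * ‖S k‖ * ‖S k‖ := Q.le_opNorm₂ _ _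
    _ ≤ ‖Q‖ * (‖S‖ * ‖k‖) * (‖S‖ * ‖k‖) := by
        gcongr
        · exact S.le_opNorm k
        · exact S.le_opNorm k
    _ = ‖Q‖ * ‖S‖ ^ 2 * ‖k‖ ^ 2 := by ring

/-! ## §2. Coercivity transport through a right inverse -/

/-- A right inverse `S` of `D` maps `ker D⁺` into `ker (D⁺ ∘ D)`. [folklore] -/
theorem mem_ker_comp_of_rightInverse {D : E →L[ℝ] F} {S : F →L[ℝ] E} (hS : ∀ k, D (S k) = k) (Dn : F →L[ℝ] F')
    {k : F} (hk : Dn k = 0) : Dn (D (S k)) = 0 := by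
  rw [hS, hk]

/-- The size letter read backwards through a right inverse: `‖D v‖ ≤ d‖v‖` and `D (S k) = k` give `‖k‖ ≤ d‖S k‖`. [folklore] -/
theorem norm_le_mul_norm_rightInverse {D : E →L[ℝ] F} {S : F →L[ℝ] E} (hS : ∀ k, D (S k) = k) {d : ℝ}
    (hd : ∀ v, ‖D v‖ ≤ d * ‖v‖) (k : F) : ‖k‖ ≤ d * ‖S k‖ := by
  have h := hd (S k)
  rwa [hS] at h

/-- **COERCIVITY TRANSPORT, DIVISION-FREE**: the two-scale letter `∀ v, D⁺ (D v) = 0 → m₂‖v‖² ≤ Q v v`, a right inverse `S` of `D`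
and `‖D v‖ ≤ d‖v‖` give, for every `k ∈ ker D⁺`, `m₂‖k‖² ≤ d²·Q⁺ k k` with `Q⁺ = Q.bilinearComp S S` (`0 ≤ m₂`). [folklore] -/
theorem kerCoercive_bilinearComp {Q : E →L[ℝ] E →L[ℝ] ℝ} {D : E →L[ℝ] F} {S : F →L[ℝ] E} (hS : ∀ k, D (S k) = k)
    (Dn : F →L[ℝ] F') {m₂ : ℝ} (hm₂ : 0 ≤ m₂) (hco : ∀ v, Dn (D v) = 0 → m₂ * ‖v‖ ^ 2 ≤ Q v v) {d : ℝ}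
    (hd : ∀ v, ‖D v‖ ≤ d * ‖v‖) (k : F) (hk : Dn k = 0) :
    m₂ * ‖k‖ ^ 2 ≤ d ^ 2 * Q.bilinearComp S S k k := by
  have h1 : m₂ * ‖S k‖ ^ 2 ≤ Q (S k) (S k) := hco (S k) (mem_ker_comp_of_rightInverse hS Dn hk)
  have h2 : ‖k‖ ≤ d * ‖S k‖ := norm_le_mul_norm_rightInverse hS hd k
  have h3 : ‖k‖ ^ 2 ≤ d ^ 2 * ‖S k‖ ^ 2 := by
    rw [← mul_pow]
    exact pow_le_pow_left₀ (norm_nonneg _) h2 2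
  rw [bilinearComp_apply']
  calc m₂ * ‖k‖ ^ 2 ≤ m₂ * (d ^ 2 * ‖S k‖ ^ 2) := mul_le_mul_of_nonneg_left h3 hm₂
    _ = d ^ 2 * (m₂ * ‖S k‖ ^ 2) := by ring
    _ ≤ d ^ 2 * Q (S k) (S k) := mul_le_mul_of_nonneg_left h1 (by positivity)

/-- **THE NEXT SCALE'S KERNEL COERCIVITY LETTER** (`…AugmentedHessianEquivalence`'s `hco` at scale `+`, VERBATIM shape): `0 < d` ⟹
`∀ k, D⁺ k = 0 → (m₂∕d²)‖k‖² ≤ (Q.bilinearComp S S) k k`. [folklore] -/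
theorem kerCoercive_bilinearComp_div {Q : E →L[ℝ] E →L[ℝ] ℝ} {D : E →L[ℝ] F} {S : F →L[ℝ] E} (hS : ∀ k, D (S k) = k)
    (Dn : F →L[ℝ] F') {m₂ : ℝ} (hm₂ : 0 ≤ m₂) (hco : ∀ v, Dn (D v) = 0 → m₂ * ‖v‖ ^ 2 ≤ Q v v) {d : ℝ} (hd0 : 0 < d)
    (hd : ∀ v, ‖D v‖ ≤ d * ‖v‖) :
    ∀ k, Dn k = 0 → m₂ / d ^ 2 * ‖k‖ ^ 2 ≤ Q.bilinearComp S S k k := by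
  intro k hk
  have h := kerCoercive_bilinearComp hS Dn hm₂ hco hd k hk
  have hd2 : 0 < d ^ 2 := by positivity
  rw [div_mul_eq_mul_div, div_le_iff₀ hd2]
  linarith

/-- THE TWO-SCALE LETTER RESTRICTS TO THE CURRENT ONE: `ker D ⊆ ker (D⁺ ∘ D)`, so `∀ κ, D κ = 0 → m₂‖κ‖² ≤ Q κ κ` — AHE's `hco` at the
CURRENT scale from the same letter. [folklore] -/
theorem kerCoercive_of_twoScale {Q : E →L[ℝ] E →L[ℝ] ℝ} {D : E →L[ℝ] F} (Dn : F →L[ℝ] F') {m₂ : ℝ}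
    (hco : ∀ v, Dn (D v) = 0 → m₂ * ‖v‖ ^ 2 ≤ Q v v) : ∀ κ, D κ = 0 → m₂ * ‖κ‖ ^ 2 ≤ Q κ κ :=
  fun κ hκ => hco κ (by rw [hκ, map_zero])

/-! ## §3. Special cases and monotonicity -/

/-- A fully coercive `Q` satisfies the two-scale letter for EVERY next averaging `D⁺`. [folklore] -/
theorem twoScale_of_coercive {Q : E →L[ℝ] E →L[ℝ] ℝ} (D : E →L[ℝ] F) (Dn : F →L[ℝ] F') {m : ℝ}
    (hco : ∀ v, m * ‖v‖ ^ 2 ≤ Q v v) : ∀ v, Dn (D v) = 0 → m * ‖v‖ ^ 2 ≤ Q v v :=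
  fun v _ => hco v

/-- **FULL COERCIVITY PASSES THROUGH A RIGHT INVERSE** (the `D⁺ = 0` instance): `m‖v‖² ≤ Q v v` on all of `E`, `D (S k) = k`,
`‖D v‖ ≤ d‖v‖`, `0 < d`, `0 ≤ m` ⟹ `(m∕d²)‖k‖² ≤ Q⁺ k k` for EVERY `k`. [folklore] -/
theorem coercive_bilinearComp_of_coercive {Q : E →L[ℝ] E →L[ℝ] ℝ} {D : E →L[ℝ] F} {S : F →L[ℝ] E} (hS : ∀ k, D (S k) = k)
    {m : ℝ} (hm : 0 ≤ m) (hco : ∀ v, m * ‖v‖ ^ 2 ≤ Q v v) {d : ℝ} (hd0 : 0 < d) (hd : ∀ v, ‖D v‖ ≤ d * ‖v‖) (k : F) :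
    m / d ^ 2 * ‖k‖ ^ 2 ≤ Q.bilinearComp S S k k :=
  kerCoercive_bilinearComp_div hS (0 : F →L[ℝ] F) hm (twoScale_of_coercive D 0 hco) hd0 hd k (by simp)

/-- MONOTONICITY IN THE LETTER: any smaller modulus `m′ ≤ m₂∕d²` is again a kernel-coercivity letter for `Q⁺`. [folklore] -/
theorem kerCoercive_bilinearComp_of_le {Q : E →L[ℝ] E →L[ℝ] ℝ} {D : E →L[ℝ] F} {S : F →L[ℝ] E} (hS : ∀ k, D (S k) = k)
    (Dn : F →L[ℝ] F') {m₂ : ℝ} (hm₂ : 0 ≤ m₂) (hco : ∀ v, Dn (D v) = 0 → m₂ * ‖v‖ ^ 2 ≤ Q v v) {d : ℝ} (hd0 : 0 < d)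
    (hd : ∀ v, ‖D v‖ ≤ d * ‖v‖) {m' : ℝ} (hm' : m' ≤ m₂ / d ^ 2) :
    ∀ k, Dn k = 0 → m' * ‖k‖ ^ 2 ≤ Q.bilinearComp S S k k := fun k hk =>
  (mul_le_mul_of_nonneg_right hm' (sq_nonneg _)).trans (kerCoercive_bilinearComp_div hS Dn hm₂ hco hd0 hd k hk)

/-- THE OPERATOR-NORM FORM OF THE SIZE LETTER: `‖D v‖ ≤ ‖D‖‖v‖`, so `d := ‖D‖` is always admissible (then `0 < ‖D‖` is the
nondegeneracy asked by the division form; on `F ≠ 0` with a right inverse it holds). [folklore] -/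
theorem kerCoercive_bilinearComp_opNorm {Q : E →L[ℝ] E →L[ℝ] ℝ} {D : E →L[ℝ] F} {S : F →L[ℝ] E} (hS : ∀ k, D (S k) = k)
    (Dn : F →L[ℝ] F') {m₂ : ℝ} (hm₂ : 0 ≤ m₂) (hco : ∀ v, Dn (D v) = 0 → m₂ * ‖v‖ ^ 2 ≤ Q v v) (k : F) (hk : Dn k = 0) :
    m₂ * ‖k‖ ^ 2 ≤ ‖D‖ ^ 2 * Q.bilinearComp S S k k :=
  kerCoercive_bilinearComp hS Dn hm₂ hco (fun v => D.le_opNorm v) k hk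

/-- With a right inverse on a nontrivial target, `0 < ‖D‖` (so the division form applies with `d := ‖D‖`). [folklore] -/
theorem opNorm_pos_of_rightInverse [Nontrivial F] {D : E →L[ℝ] F} {S : F →L[ℝ] E} (hS : ∀ k, D (S k) = k) : 0 < ‖D‖ := by
  obtain ⟨k, hk⟩ := exists_ne (0 : F)
  refine lt_of_le_of_ne (norm_nonneg _) fun h0 => hk ?_
  have h1 : ‖D (S k)‖ ≤ ‖D‖ * ‖S k‖ := D.le_opNorm (S k)
  rw [hS, ← h0, zero_mul] at h1
  exact norm_le_zero_iff.mp h1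

/-! ## §4. Toy -/

/-- Toy: `E = F = F′ = ℝ`, `Q x y = x·y`, `D = S = id`, `D⁺ = 0`, `m₂ = 1`, `d = 1`: the transported form is `Q` itself and the
next letter reads `(1∕1²)‖k‖² ≤ k·k`. [folklore] -/
example (k : ℝ) :
    (1 : ℝ) / 1 ^ 2 * ‖k‖ ^ 2 ≤
      (ContinuousLinearMap.mul ℝ ℝ).bilinearComp (ContinuousLinearMap.id ℝ ℝ) (ContinuousLinearMap.id ℝ ℝ) k k :=
  coercive_bilinearComp_of_coercive (Q := ContinuousLinearMap.mul ℝ ℝ) (D := ContinuousLinearMap.id ℝ ℝ)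
    (S := ContinuousLinearMap.id ℝ ℝ) (fun _ => rfl) zero_le_one
    (fun v => by rw [ContinuousLinearMap.mul_apply', one_mul, Real.norm_eq_abs, sq_abs, sq]) one_pos (fun v => by simp) k

/-- Toy of the TOWER use: the two-scale letter one level further up is the same lemma with the COMPOSITE next averaging
`D⁺⁺ ∘ D⁺` in the rôle of `D⁺` — from `Q` coercive on `ker (D⁺⁺ ∘ D⁺ ∘ D)` to `Q⁺` coercive on `ker (D⁺⁺ ∘ D⁺)` (the letter the
step after next asks of `Q⁺`). [folklore] -/
example {F'' : Type*} [NormedAddCommGroup F''] [NormedSpace ℝ F''] {Q : E →L[ℝ] E →L[ℝ] ℝ} {D : E →L[ℝ] F} {S : F →L[ℝ] E}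
    (hS : ∀ k, D (S k) = k) (Dn : F →L[ℝ] F') (Dnn : F' →L[ℝ] F'') {m₃ : ℝ} (hm₃ : 0 ≤ m₃)
    (hco : ∀ v, Dnn (Dn (D v)) = 0 → m₃ * ‖v‖ ^ 2 ≤ Q v v) {d : ℝ} (hd0 : 0 < d) (hd : ∀ v, ‖D v‖ ≤ d * ‖v‖) :
    ∀ k, Dnn (Dn k) = 0 → m₃ / d ^ 2 * ‖k‖ ^ 2 ≤ Q.bilinearComp S S k k := fun k hk =>
  kerCoercive_bilinearComp_div hS (Dnn.comp Dn) hm₃ (fun v hv => hco v hv) hd0 hd k hk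

end Summit.QuantumFields.BalabanUV.T4Continuum.NE7b.TransportedFormCoercivity
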